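import Mathlib
import Literature.NumberTheory.Automorphic.HilbertModularFormQExpansion

/-!
# Named fact (i) of the Hilbert classicality assembly, reduced to its classical form: STURM MOD 𝔭 + BOUNDED DENOMINATORS
# (line `Sketch-ideate-r1-k1`, § T, crux stmt-Langlands-8485)

The end-to-end assembly `hilbertClassicalityModuloNamedFacts` consumes named fact (i) in SUP-NORM form: for an `E`-rational Hilbert
modular form, the `v`-adic bound `‖v(q ν)‖ ≤ B` on the trace window propagates to the whole cone.  The statement in print (Sturm
1987 for `d = 1`; Burgos Gil–Pacetti for `d = 2`; the toroidal argument of the crux NOTES in general) is STURM MOD 𝔭: a `v`-INTEGRAL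
`E`-rational form whose coefficients on the window have norm `< 1` has all coefficients of norm `< 1`.  Together with BOUNDED
DENOMINATORS (the coefficients of an `E`-rational form are `v`-adically bounded — the `q`-expansion principle) it implies the sup-norm
form: `hcm_sturmSupNorm_of_modP`.  The bridge is the DISCRETENESS of the `v`-adic absolute value on the number field `E`
(`hcm_norm_v_eq_rpow`: `‖v x‖ = p^{k/m}` with `1 ≤ m ≤ [E:ℚ]`, from the spectral norm on `ℚ̄_p` = `|a₀|^{1/deg}` of the minimal
polynomial), which makes the maximum of the norms of the coefficients ATTAINED (`hcm_exists_max_norm`); rescaling by the maximal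
coefficient turns the sup-norm statement into Sturm mod 𝔭.
-/

set_option linter.dupNamespace false

noncomputable section

namespace Summit.Langlands.Langlands.Theorems.HilbertIntegralOverconvergentIsCongruence

open MeasureTheory Complex NumberField Polynomial
open Literature.NumberTheory.Automorphic Literature.NumberTheory.Automorphic.HilbertModular
open scoped MatrixGroups NumberField

/-- **Discreteness of a `p`-adic absolute value on a number field.**  For `v : E → ℚ̄_p` and `x ≠ 0` in the number field `E`,
`‖v x‖ = p^{k/m}` for some integer `k` and some `1 ≤ m ≤ [E:ℚ]` (`m` = the degree of `v x` over `ℚ_p`, `p^k = |a₀|_p⁻¹…`: the norm of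
`ℚ̄_p` is the spectral norm, equal to `|a₀|^{1/m}` for the constant coefficient `a₀` of the minimal polynomial over `ℚ_p`,
`spectralNorm.spectralNorm_eq_norm_coeff_zero_rpow`; and `|a₀|_p ∈ p^ℤ`). [folklore] -/
theorem hcm_norm_v_eq_rpow (E : Type) [Field E] [NumberField E] (p : ℕ) [Fact p.Prime] (v : E →+* PadicAlgCl p)
    (x : E) (hx : x ≠ 0) :
    ∃ (m : ℕ) (k : ℤ), 1 ≤ m ∧ m ≤ Module.finrank ℚ E ∧ ‖v x‖ = (p : ℝ) ^ ((k : ℝ) / m) := by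
  set y : PadicAlgCl p := v x with hydef
  have hy0 : y ≠ 0 := by rw [hydef]; exact (map_ne_zero v).2 hx
  -- `y` is a root of the (mapped) minimal polynomial of `x` over `ℚ`
  have hxint : IsIntegral ℚ x := Algebra.IsIntegral.isIntegral x
  set P : ℚ[X] := minpoly ℚ x with hPdef
  have hPy : aeval y (P.map (algebraMap ℚ ℚ_[p])) = 0 := by
    rw [aeval_map_algebraMap, hydef, show (v x : PadicAlgCl p) = (v.toRatAlgHom : E →ₐ[ℚ] PadicAlgCl p) x from rfl,
      aeval_algHom_apply, hPdef, minpoly.aeval, map_zero]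
  have hPmonic : (P.map (algebraMap ℚ ℚ_[p])).Monic := (minpoly.monic hxint).map _
  have hyint : IsIntegral ℚ_[p] y := ⟨_, hPmonic, by rwa [← aeval_def]⟩
  -- degree bound
  set Q : ℚ_[p][X] := minpoly ℚ_[p] y with hQdef
  have hQdvd : Q ∣ P.map (algebraMap ℚ ℚ_[p]) := minpoly.dvd ℚ_[p] y hPy
  have hm1 : 1 ≤ Q.natDegree := Nat.one_le_iff_ne_zero.2 (minpoly.natDegree_pos hyint).ne'
  have hmle : Q.natDegree ≤ Module.finrank ℚ E := by
    calc Q.natDegree ≤ (P.map (algebraMap ℚ ℚ_[p])).natDegree :=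
          natDegree_le_of_dvd hQdvd hPmonic.ne_zero
      _ = P.natDegree := natDegree_map _
      _ ≤ Module.finrank ℚ E := minpoly.natDegree_le x
  -- the constant coefficient
  have ha0 : Q.coeff 0 ≠ 0 := minpoly.coeff_zero_ne_zero hyint hy0
  have hnorm : ‖y‖ = ‖Q.coeff 0‖ ^ (1 / Q.natDegree : ℝ) := by
    rw [← PadicAlgCl.spectralNorm_eq, hQdef]
    exact spectralNorm.spectralNorm_eq_norm_coeff_zero_rpow ℚ_[p] (PadicAlgCl p) y
  have hp : (1 : ℝ) < p := by exact_mod_cast (Fact.out : p.Prime).one_lt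
  refine ⟨Q.natDegree, -(Q.coeff 0).valuation, hm1, hmle, ?_⟩
  rw [hnorm, Padic.norm_eq_zpow_neg_valuation ha0, ← Real.rpow_intCast, ← Real.rpow_mul (by positivity)]
  congr 1
  rw [one_div, div_eq_mul_inv]

/-- **The maximum of the `v`-adic norms of a bounded family of elements of a number field is attained** (discreteness: the possible
norms in `[s, C]`, `s > 0`, form a finite set). [folklore] -/
theorem hcm_exists_max_norm (E : Type) [Field E] [NumberField E] (p : ℕ) [Fact p.Prime] (v : E →+* PadicAlgCl p)
    {ι : Type} (S : Set ι) (q : ι → E) (C : ℝ) (hC : ∀ i ∈ S, ‖v (q i)‖ ≤ C) (i₁ : ι) (hi₁ : i₁ ∈ S) :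
    ∃ i₀ ∈ S, ∀ i ∈ S, ‖v (q i)‖ ≤ ‖v (q i₀)‖ := by
  classical
  by_cases hzero : ∀ i ∈ S, q i = 0
  · exact ⟨i₁, hi₁, fun i hi ↦ by rw [hzero i hi, hzero i₁ hi₁]⟩
  push Not at hzero
  obtain ⟨i₂, hi₂, hq2⟩ := hzero
  set s : ℝ := ‖v (q i₂)‖ with hsdef
  have hs : 0 < s := norm_pos_iff.2 ((map_ne_zero v).2 hq2)
  have hp : (1 : ℝ) < p := by exact_mod_cast (Fact.out : p.Prime).one_lt
  have hp0 : (0 : ℝ) < p := by positivity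
  -- the finite set of candidate values `p^{k/m}` in `[s, C]`
  set N : ℕ := Module.finrank ℚ E with hNdef
  set Kb : ℕ := N * (⌈|Real.logb p s|⌉₊ + ⌈|Real.logb p C|⌉₊) + 1 with hKbdef
  set T : Set ℝ := (fun mk : ℕ × ℤ ↦ (p : ℝ) ^ ((mk.2 : ℝ) / mk.1)) ''
    ((Finset.range (N + 1) ×ˢ Finset.Icc (-(Kb : ℤ)) Kb : Finset (ℕ × ℤ)) : Set (ℕ × ℤ)) with hTdef
  have hTfin : T.Finite := (Finset.finite_toSet _).image _
  -- every norm in `[s, C]` lies in `T`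
  have hmem : ∀ i ∈ S, s ≤ ‖v (q i)‖ → ‖v (q i)‖ ∈ T := by
    intro i hi hsi
    have hqi : q i ≠ 0 := fun h ↦ by rw [h, map_zero, norm_zero] at hsi; linarith
    obtain ⟨m, k, hm1, hmN, hnorm⟩ := hcm_norm_v_eq_rpow E p v (q i) hqi
    refine ⟨(m, k), ?_, hnorm.symm⟩
    simp only [Finset.coe_product, Set.mem_prod, Finset.coe_range, Set.mem_Iio, Finset.coe_Icc, Set.mem_Icc]
    refine ⟨by omega, ?_⟩
    -- `k/m = log_p ‖v (q i)‖ ∈ [log_p s, log_p C]`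
    have hlog : Real.logb p ‖v (q i)‖ = (k : ℝ) / m := by
      rw [hnorm, Real.logb_rpow hp0 hp.ne']
    have hle1 : Real.logb p s ≤ (k : ℝ) / m := by
      rw [← hlog]; exact Real.logb_le_logb_of_le hp hs hsi
    have hle2 : (k : ℝ) / m ≤ Real.logb p C := by
      rw [← hlog]; exact Real.logb_le_logb_of_le hp (lt_of_lt_of_le hs hsi) (hC i hi)
    have hm0 : (0 : ℝ) < m := by exact_mod_cast hm1
    have hmN' : (m : ℝ) ≤ N := by exact_mod_cast hmN
    have hk1 : (m : ℝ) * Real.logb p s ≤ k := by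
      have := mul_le_mul_of_nonneg_left hle1 hm0.le
      rwa [mul_div_cancel₀ _ hm0.ne'] at this
    have hk2 : (k : ℝ) ≤ m * Real.logb p C := by
      have := mul_le_mul_of_nonneg_left hle2 hm0.le
      rwa [mul_div_cancel₀ _ hm0.ne'] at this
    have hA : |Real.logb p s| ≤ ⌈|Real.logb p s|⌉₊ := Nat.le_ceil _
    have hB : |Real.logb p C| ≤ ⌈|Real.logb p C|⌉₊ := Nat.le_ceil _
    have hKb : (Kb : ℝ) = N * ((⌈|Real.logb p s|⌉₊ : ℝ) + ⌈|Real.logb p C|⌉₊) + 1 := by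
      rw [hKbdef]; push_cast; ring
    have habs1 := abs_le.1 (le_refl |Real.logb p s|)
    have habs2 := abs_le.1 (le_refl |Real.logb p C|)
    constructor
    · have : -(Kb : ℝ) ≤ k := by
        rw [hKb]; nlinarith [habs1.1, hA, hB, hmN', hm0, abs_nonneg (Real.logb p C), abs_nonneg (Real.logb p s)]
      exact_mod_cast this
    · have : (k : ℝ) ≤ Kb := by
        rw [hKb]; nlinarith [habs2.2, hA, hB, hmN', hm0, abs_nonneg (Real.logb p C), abs_nonneg (Real.logb p s)]
      exact_mod_cast this
  -- the finite non-empty set of norms `≥ s` has a maximum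
  set U : Set ℝ := {r | ∃ i ∈ S, r = ‖v (q i)‖ ∧ s ≤ r} with hUdef
  have hUfin : U.Finite := hTfin.subset (by rintro r ⟨i, hi, rfl, hsi⟩; exact hmem i hi hsi)
  have hUne : U.Nonempty := ⟨s, i₂, hi₂, rfl, le_rfl⟩
  obtain ⟨M, ⟨i₀, hi₀, rfl, hsM⟩, hmax⟩ := hUfin.exists_maximal hUne
  refine ⟨i₀, hi₀, fun i hi ↦ ?_⟩
  by_cases hsi : s ≤ ‖v (q i)‖
  · by_contra hlt
    push Not at hlt
    exact absurd (hmax ⟨i, hi, rfl, hsi⟩ hlt.le) (not_le.2 hlt)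
  · push Not at hsi
    exact (hsi.le).trans hsM

/-- **NAMED FACT (i) in sup-norm form from STURM MOD 𝔭 + BOUNDED DENOMINATORS.**  For a window length `L`, assume (i′) Sturm mod `𝔭`:
every `E`-rational form of weight `b` and level `Γ₁(𝔫)` whose coefficient function `q` is `v`-integral on the cone and has norm `< 1` on
the trace window `{Tr(αν) < L b}` has norm `< 1` on the whole cone; and (i″) bounded denominators: the coefficients of every `E`-rational
form are `v`-adically bounded on the cone.  Then the sup-norm principle holds: `‖v(q ν)‖ ≤ B` on the window implies `‖v(q ν)‖ ≤ B` on
the cone (rescale by a coefficient of maximal norm, `hcm_exists_max_norm`). [folklore] -/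
theorem hcm_sturmSupNorm_of_modP (F : Type) [Field F] [NumberField F] (𝔫 : Ideal (𝓞 F)) (α : F)
    (E : Type) [Field E] [NumberField E] (τ : E →+* ℂ) (p : ℕ) [Fact p.Prime] (v : E →+* PadicAlgCl p)
    (L : ((F →+* ℝ) → ℤ) → ℕ)
    (hmodp : ∀ (b : (F →+* ℝ) → ℤ) (f : Point F → ℂ), f ∈ modularForms (Bianchi.Gamma1 𝔫) b →
      ∀ q : F → E, (∀ ν ∈ qIndexSet F, fourierCoeff f ν = τ (q ν)) → (∀ ν ∈ qIndexSet F, ‖v (q ν)‖ ≤ 1) →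
      (∀ ν ∈ qIndexSet F, ((Algebra.trace ℚ F (α * ν) : ℚ) : ℝ) < L b → ‖v (q ν)‖ < 1) →
      ∀ ν ∈ qIndexSet F, ‖v (q ν)‖ < 1)
    (hbdd : ∀ (b : (F →+* ℝ) → ℤ) (f : Point F → ℂ), f ∈ modularForms (Bianchi.Gamma1 𝔫) b →
      ∀ q : F → E, (∀ ν ∈ qIndexSet F, fourierCoeff f ν = τ (q ν)) → ∃ C : ℝ, ∀ ν ∈ qIndexSet F, ‖v (q ν)‖ ≤ C)
    (b : (F →+* ℝ) → ℤ) (f : Point F → ℂ) (hf : f ∈ modularForms (Bianchi.Gamma1 𝔫) b)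
    (q : F → E) (hq : ∀ ν ∈ qIndexSet F, fourierCoeff f ν = τ (q ν)) (B : ℝ) (hB : 0 ≤ B)
    (hwin : ∀ ν ∈ qIndexSet F, ((Algebra.trace ℚ F (α * ν) : ℚ) : ℝ) < L b → ‖v (q ν)‖ ≤ B) :
    ∀ ν ∈ qIndexSet F, ‖v (q ν)‖ ≤ B := by
  classical
  obtain ⟨C, hC⟩ := hbdd b f hf q hq
  obtain ⟨ν₀, hν₀, hmax⟩ := hcm_exists_max_norm E p v (qIndexSet F) q C hC 0 zero_mem_qIndexSet
  set M : ℝ := ‖v (q ν₀)‖ with hMdef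
  by_cases hMB : M ≤ B
  · exact fun ν hν ↦ (hmax ν hν).trans hMB
  push Not at hMB
  exfalso
  have hM0 : 0 < M := hB.trans_lt hMB
  have hq0 : q ν₀ ≠ 0 := fun h ↦ by rw [hMdef, h, map_zero, norm_zero] at hM0; exact lt_irrefl _ hM0
  have hvq0 : v (q ν₀) ≠ 0 := (map_ne_zero v).2 hq0
  -- rescale: `f' := (τ (q ν₀))⁻¹ • f`, `q' := (q ν₀)⁻¹ * q`
  set q' : F → E := fun ν ↦ (q ν₀)⁻¹ * q ν with hq'def
  have hf' : (τ (q ν₀))⁻¹ • f ∈ modularForms (Bianchi.Gamma1 𝔫) b := Submodule.smul_mem _ _ hf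
  have hq' : ∀ ν ∈ qIndexSet F, fourierCoeff ((τ (q ν₀))⁻¹ • f) ν = τ (q' ν) := by
    intro ν hν
    have hsmul : (τ (q ν₀))⁻¹ • f = fun z ↦ (τ (q ν₀))⁻¹ * f z := by
      funext z; simp [Pi.smul_apply, smul_eq_mul]
    rw [hsmul, fourierCoeff_eq, fourierCoeffAt_const_mul, ← fourierCoeff_eq, hq ν hν, hq'def]
    simp only [map_mul, map_inv₀]
  have hnorm' : ∀ ν, ‖v (q' ν)‖ = ‖v (q ν)‖ / M := by
    intro ν
    rw [hq'def]
    simp only [map_mul, map_inv₀, norm_mul, norm_inv, hMdef]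
    rw [div_eq_inv_mul]
  have hint : ∀ ν ∈ qIndexSet F, ‖v (q' ν)‖ ≤ 1 := fun ν hν ↦ by
    rw [hnorm', div_le_one hM0]; exact hmax ν hν
  have hwin' : ∀ ν ∈ qIndexSet F, ((Algebra.trace ℚ F (α * ν) : ℚ) : ℝ) < L b → ‖v (q' ν)‖ < 1 := fun ν hν hνL ↦ by
    rw [hnorm', div_lt_one hM0]; exact (hwin ν hν hνL).trans_lt hMB
  have h1 := hmodp b _ hf' q' hq' hint hwin' ν₀ hν₀
  rw [hnorm', hMdef, div_self (norm_ne_zero_iff.2 hvq0)] at h1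
  exact lt_irrefl _ h1

end Summit.Langlands.Langlands.Theorems.HilbertIntegralOverconvergentIsCongruence

end
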